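import Literature.Probability.RandomPlanarGeometry.SAWCountMonotoneNearPolygonRule
import Literature.Probability.RandomPlanarGeometry.SAWCountMonotoneEscapeOdd
import HarnessLib

/-!
# Monotonicity `cₙ ≤ cₙ₊₁` (O'Brien 1990) AT `n = 6d - 1` FOR EVERY `d ≥ 4`: no third cage, no far cage —
# the residual of the near-polygon rule is empty at the first length beyond the escape route

Sequel of `SAWCountMonotoneNearPolygonRule.lean` (`cₙ ≤ cₙ₊₁ + #(R \ npClass d n)`: residual near-polygons with a
unique doubly-caged cycle edge are disposed of by rotation) and `SAWCountMonotoneEscapeOdd.lean` (the escape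
residual `R(d, n)` is empty exactly for `n ≤ 6d - 3` odd / `8d - 6` even, and has no pocketed walks at odd
`n ≤ 7d - 5`).  Two parity counts finish the length `n = 6d - 1`:

1. NO THIRD CAGE.  If `n` is odd and the start is surrounded, a caged site at an EVEN time `i ≠ 0` puts its
   `2d` neighbours, like the `2d` neighbours of the origin, among the `(n+1)/2` odd-time sites (`≤ 2` in
   common): `4d - 2 ≤ (n+1)/2`; symmetrically for a caged odd-time site other than the trapped end.  So for
   odd `n ≤ 8d - 7` the doubly-caged cycle edge of a both-trapped near-polygon is automatically unique
   (`mem_npClass_of_adj`), and the residual of the near-polygon rule is the pocketed class plus the «far»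
   both-trapped walks, `ω n ≁ ω 0` (`count_le_count_succ_add_card_far`).
2. NO FAR CAGE.  When `e = ω n` is trapped, the start surrounded and `e ≁ 0` (`n` odd), the start-cage
   count of `SAWCountMonotoneBothTrappedOdd.lean` gets one more input: a SPECIAL odd time `j` (`ω j ∼ 0`
   with an exceptional even neighbour time) that still has a cage-time neighbour carries `ω j` within
   `ℓ¹`-distance `2` of `e` — and so does every GENERIC time; the sites `e - ω j` are neighbours of `e` in
   the ball of radius `2` — at most three (`card_filter_nbrs_normOne_le_two_le`) — so at most three start-cage
   times have a cage-time neighbour at all; the other special times are paid twice by the exceptional times.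
   Hence `2d ≤ #exceptional + 2`, i.e. **`8d ≤ n + 5`** (`le_of_bothTrapped_far`; sharp for `d = 3` by the census).

At `n = 6d - 1` with `d ≥ 4` neither pockets (`7d - 5 ≥ 6d - 1`), nor third cages (`8d - 7 ≥ 6d - 1`), nor far
cages (`8d - 5 > 6d - 1`) exist, so the escape injection + the near-polygon rule is a complete injection
`𝒲₆d₋₁ → 𝒲₆d`:

* `le_of_caged_even`, `le_of_caged_odd`, `mem_npClass_of_adj`, `count_le_count_succ_add_card_far`,
  `count_le_count_succ_add_card_far_threshold`;
* `le_of_bothTrapped_far`;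
* `count_le_count_succ_six_mul_sub_one` : **`c₆d₋₁ ≤ c₆d` for every `d ≥ 4`**;
* `count_le_count_succ_of_le_six_mul'` : `cₙ ≤ cₙ₊₁` for ALL `n ≤ 6d - 1`, `d ≥ 4`;
* `count_mono_of_le_six_mul` : **`cₘ ≤ cₙ` for `m ≤ n ≤ 6d + 1`, `d ≥ 4`** (`d = 4`: `n ≤ 25`; `d = 5`: `n ≤ 31`).

This is the first length proved BEYOND both reductions (reversal `T₂`, escape `R`), by an actual surgery on
the residual class.  Exhaustive enumeration (lane «pcv-sawmu» a-p4 g27, kit j312058 / j312060; not used in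
proofs) shows the same mechanism covers `d = 2, 3` at `n = 6d - 1` (`R \ npClass = ∅` there), where the counts
above are one unit short for `d = 3` (pockets: `7d - 5 = 16 < 17`; the far-cage count is sharp: none below `8d - 5 = 19`).

[cite: MadrasSlade1993, §1.1, §1.2 p. 10; §7.1 p. 231 (`c_{N+1} ≥ c_N`, O'Brien)]
[cite: BDGS2012, §1.1 eq. (1.1); §1.3 (`cₙ ≤ cₙ₊₁`, O'Brien 1990)]
-/

noncomputable section

open Literature.Probability.LatticeModels Literature.Probability.Percolation SimpleGraph

namespace Literature.Probability.RandomPlanarGeometry.SAW.Zd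

variable {d : ℕ}

/-- **A caged even-time site other than the origin costs `4d - 2` odd-time sites**: if the start of the
`n`-step self-avoiding walk `ω` is surrounded and `ω i`, `i ≤ n` even, `i ≠ 0`, is caged, then
`4d - 2 ≤ (n+1)/2`. [cite: MadrasSlade1993, §1.2, p. 10] -/
theorem le_of_caged_even {ω : ℕ → Site d} {n i : ℕ} (hω : ω ∈ saws d n)
    (hb : extCount (revWalk n ω) n = 0) (hi : i ≤ n) (hieven : i % 2 = 0) (hi0 : i ≠ 0)
    (hc : Caged ω n (ω i)) : 4 * d ≤ (n + 1) / 2 + 2 := by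
  classical
  obtain ⟨h00, -, -, hinj⟩ := mem_saws.1 hω
  have hinj' : ∀ a ≤ n, ∀ b ≤ n, ω a = ω b → a = b := fun a ha b hb' h =>
    hinj (show a ∈ {i | i ≤ n} from ha) (show b ∈ {i | i ≤ n} from hb') h
  have hx0 : ω i ≠ 0 := fun h => hi0 (hinj' i hi 0 (Nat.zero_le n) (h.trans h00.symm))
  set O := ((Finset.range (n + 1)).filter fun j => j % 2 = 1).image ω with hO
  have hOcard : O.card ≤ (n + 1) / 2 :=
    Finset.card_image_le.trans (by have := card_filter_range_odd_le (n + 1); omega)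
  have hOmem : ∀ j ≤ n, j % 2 = 1 → ω j ∈ O := fun j hj hpar =>
    Finset.mem_image.2 ⟨j, Finset.mem_filter.2 ⟨Finset.mem_range.2 (by omega), hpar⟩, rfl⟩
  have hc0 := caged_start_of_extCount_revWalk_eq_zero hω hb
  have hN0 : nbrs (ω 0) ⊆ O := by
    intro z hz
    obtain ⟨j, hj, hjz⟩ := hc0 z (mem_nbrs.1 hz)
    have hpar := odd_add_of_adj_apply_apply hω (Nat.zero_le n) hj (by rw [hjz]; exact mem_nbrs.1 hz)
    rw [← hjz]; exact hOmem j hj (by omega)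
  have hNx : nbrs (ω i) ⊆ O := by
    intro z hz
    obtain ⟨j, hj, hjz⟩ := hc (z) (mem_nbrs.1 hz)
    have hpar := odd_add_of_adj_apply_apply hω hi hj (by rw [hjz]; exact mem_nbrs.1 hz)
    rw [← hjz]; exact hOmem j hj (by omega)
  have hinter : (nbrs (ω 0) ∩ nbrs (ω i)).card ≤ 2 := by
    have hsub : nbrs (ω 0) ∩ nbrs (ω i) ⊆
        (nbrs (ω 0)).filter fun z => (zdGraph d).Adj (ω 0) z ∧ (zdGraph d).Adj z (ω i) := by
      intro z hz
      obtain ⟨h1, h2⟩ := Finset.mem_inter.1 hz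
      exact Finset.mem_filter.2 ⟨h1, mem_nbrs.1 h1, (mem_nbrs.1 h2).symm⟩
    refine (Finset.card_le_card hsub).trans (card_filter_adj_adj_le_two ?_ _)
    rw [h00]; exact hx0.symm
  have hunion := Finset.card_le_card (Finset.union_subset hN0 hNx)
  have hIE := Finset.card_union_add_card_inter (nbrs (ω 0)) (nbrs (ω i))
  rw [card_nbrs, card_nbrs] at hIE
  omega

/-- **A caged odd-time site other than the trapped end costs `4d - 2` even-time sites** (`n` odd).
[cite: MadrasSlade1993, §1.2, p. 10] -/
theorem le_of_caged_odd {ω : ℕ → Site d} {n i : ℕ} (hω : ω ∈ saws d n) (hodd : Odd n)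
    (ht : extCount ω n = 0) (hi : i ≤ n) (hiodd : i % 2 = 1) (hin : i ≠ n)
    (hc : Caged ω n (ω i)) : 4 * d ≤ (n + 1) / 2 + 2 := by
  classical
  obtain ⟨h00, -, -, hinj⟩ := mem_saws.1 hω
  have hn1 : n % 2 = 1 := Nat.odd_iff.1 hodd
  have hinj' : ∀ a ≤ n, ∀ b ≤ n, ω a = ω b → a = b := fun a ha b hb' h =>
    hinj (show a ∈ {i | i ≤ n} from ha) (show b ∈ {i | i ≤ n} from hb') h
  have hxe : ω i ≠ ω n := fun h => hin (hinj' i hi n le_rfl h)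
  set E := ((Finset.range (n + 1)).filter fun j => j % 2 = 0).image ω with hE
  have hEcard : E.card ≤ (n + 1) / 2 :=
    Finset.card_image_le.trans (by have := card_filter_range_even_le (n + 1); omega)
  have hEmem : ∀ j ≤ n, j % 2 = 0 → ω j ∈ E := fun j hj hpar =>
    Finset.mem_image.2 ⟨j, Finset.mem_filter.2 ⟨Finset.mem_range.2 (by omega), hpar⟩, rfl⟩
  have hce := caged_end_of_extCount_eq_zero ht
  have hNe : nbrs (ω n) ⊆ E := by
    intro z hz
    obtain ⟨j, hj, hjz⟩ := hce z (mem_nbrs.1 hz)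
    have hpar := odd_add_of_adj_apply hω hj (by rw [hjz]; exact mem_nbrs.1 hz)
    rw [← hjz]; exact hEmem j hj (by omega)
  have hNx : nbrs (ω i) ⊆ E := by
    intro z hz
    obtain ⟨j, hj, hjz⟩ := hc z (mem_nbrs.1 hz)
    have hpar := odd_add_of_adj_apply_apply hω hi hj (by rw [hjz]; exact mem_nbrs.1 hz)
    rw [← hjz]; exact hEmem j hj (by omega)
  have hinter : (nbrs (ω n) ∩ nbrs (ω i)).card ≤ 2 := by
    have hsub : nbrs (ω n) ∩ nbrs (ω i) ⊆
        (nbrs (ω n)).filter fun z => (zdGraph d).Adj (ω n) z ∧ (zdGraph d).Adj z (ω i) := by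
      intro z hz
      obtain ⟨h1, h2⟩ := Finset.mem_inter.1 hz
      exact Finset.mem_filter.2 ⟨h1, mem_nbrs.1 h1, (mem_nbrs.1 h2).symm⟩
    exact (Finset.card_le_card hsub).trans (card_filter_adj_adj_le_two hxe.symm _)
  have hunion := Finset.card_le_card (Finset.union_subset hNe hNx)
  have hIE := Finset.card_union_add_card_inter (nbrs (ω n)) (nbrs (ω i))
  rw [card_nbrs, card_nbrs] at hIE
  omega

open Classical in
/-- **At odd `n ≤ 8d - 7` a both-trapped residual walk whose end is adjacent to its start lies in
`npClass`**: there is no third cage. [cite: BDGS2012, §1.3] -/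
theorem mem_npClass_of_adj {n : ℕ} (hodd : Odd n) (hn : n + 7 ≤ 8 * d) {ω : ℕ → Site d}
    (hR : ω ∈ escapeResidual d n) (ht : extCount ω n = 0) (hadj0 : (zdGraph d).Adj (ω n) (ω 0)) :
    ω ∈ npClass d n := by
  obtain ⟨hω, -, hb⟩ := mem_escapeResidual.1 hR
  have hn1 : n % 2 = 1 := Nat.odd_iff.1 hodd
  have h4 : 4 * d ≤ n + 1 := four_mul_le_of_extCount_eq_zero hω ht
  refine mem_npClass.2 ⟨hR, ht, hadj0, fun i hi ⟨hci, hci1⟩ => ?_⟩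
  rcases Nat.even_or_odd i with ⟨k, hk⟩ | ⟨k, hk⟩
  · -- `i` even: if `i ≠ 0` the site `ω i` is a third cage; if `i = 0`, look at `ω 1`
    rcases Nat.eq_zero_or_pos i with rfl | hipos
    · have h := le_of_caged_odd hω hodd ht (by omega : 1 ≤ n) rfl (by omega) (by simpa using hci1)
      omega
    · have h := le_of_caged_even hω hb hi.le (by omega) (by omega) hci
      omega
  · -- `i` odd: `i + 1` is even and nonzero
    have h := le_of_caged_even hω hb (by omega : i + 1 ≤ n) (by omega) (by omega) hci1
    omega

open Classical in
/-- **The residual of the near-polygon rule at odd `n ≤ 8d - 7`** (`d ≥ 2`):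
`cₙ ≤ cₙ₊₁ + #{ω ∈ R(d,n) : extCount ω n ≠ 0 ∨ ω n ≁ ω 0}` — the pocketed walks and the both-trapped walks whose
end is not next to the start. [cite: BDGS2012, §1.3] -/
theorem count_le_count_succ_add_card_far (hd : 2 ≤ d) {n : ℕ} (hodd : Odd n) (hn : n + 7 ≤ 8 * d) :
    count d n ≤ count d (n + 1) +
      ((escapeResidual d n).filter fun ω => extCount ω n ≠ 0 ∨ ¬ (zdGraph d).Adj (ω n) (ω 0)).card := by
  have hab : (⟨0, by omega⟩ : Fin d) ≠ ⟨1, by omega⟩ := by simp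
  refine (count_le_count_succ_add_card_sdiff_npClass (n := n) hab).trans (Nat.add_le_add_left
    (Finset.card_le_card fun ω hω => ?_) _)
  obtain ⟨hR, hnp⟩ := Finset.mem_sdiff.1 hω
  refine Finset.mem_filter.2 ⟨hR, ?_⟩
  by_contra h
  push Not at h
  exact hnp (mem_npClass_of_adj hodd hn hR h.1 h.2)

open Classical in
/-- **At `n = 6d - 1`, `d ≥ 4`: `c₆d₋₁ ≤ c₆d + #{ω ∈ R(d, 6d-1) : ω (6d-1) ≁ ω 0}`.**  (No pockets at this length
by `extCount_eq_zero_of_mem_escapeResidual_of_odd`; the lane's census finds the far class empty for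
`d = 2, 3`.) [cite: BDGS2012, §1.3] -/
theorem count_le_count_succ_add_card_far_threshold (hd : 4 ≤ d) {n : ℕ} (hn : n + 1 = 6 * d) :
    count d n ≤ count d (n + 1) +
      ((escapeResidual d n).filter fun ω => ¬ (zdGraph d).Adj (ω n) (ω 0)).card := by
  have hodd : Odd n := ⟨3 * d - 1, by omega⟩
  refine (count_le_count_succ_add_card_far (by omega) hodd (by omega)).trans (Nat.add_le_add_left
    (Finset.card_le_card fun ω hω => ?_) _)
  obtain ⟨hR, h⟩ := Finset.mem_filter.1 hω
  refine Finset.mem_filter.2 ⟨hR, ?_⟩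
  rcases h with h | h
  · exact absurd (extCount_eq_zero_of_mem_escapeResidual_of_odd (by omega) hodd (by omega) hR) h
  · exact h


open Classical in
/-- **A both-trapped walk whose end is not next to its start needs `n ≥ 8d - 5`** (`n` odd): see the
module docstring (sharp for `d = 3`: such walks exist at `n = 19`, lane census). [cite: MadrasSlade1993, §1.2, p. 10; §7.1] [cite: BDGS2012, §1.3] -/
theorem le_of_bothTrapped_far {n : ℕ} {ω : ℕ → Site d} (hω : ω ∈ saws d n) (hodd : Odd n)
    (h0 : extCount ω n = 0) (h1 : extCount (revWalk n ω) n = 0)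
    (h0n : ¬ (zdGraph d).Adj (ω 0) (ω n)) : 8 * d ≤ n + 5 := by
  classical
  obtain ⟨h00, -, hadj, hinj⟩ := mem_saws.1 hω
  have hn2 : n % 2 = 1 := Nat.odd_iff.1 hodd
  have hn7 : 4 * d ≤ n + 1 := four_mul_le_of_extCount_eq_zero hω h0
  have hinj' : ∀ i ≤ n, ∀ j ≤ n, ω i = ω j → i = j := fun i hi j hj h =>
    hinj (show i ∈ {i | i ≤ n} from hi) (show j ∈ {i | i ≤ n} from hj) h
  -- even times `< n`: cage times `EN` of the trapped end and exceptional times `X`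
  set P := (Finset.range n).filter fun i => i % 2 = 0 with hP
  set EN := P.filter fun i => (zdGraph d).Adj (ω n) (ω i) with hEN
  set X := P.filter fun i => ¬ (zdGraph d).Adj (ω n) (ω i) with hX
  have hPcard : P.card ≤ (n + 1) / 2 := card_filter_range_even_le n
  have hENX : EN.card + X.card = P.card := by
    rw [hEN, hX, Finset.card_filter_add_card_filter_not]
  have hENcard : 2 * d ≤ EN.card := by
    have hsub : nbrs (ω n) ⊆ EN.image ω := by
      intro y hy
      have hy' := mem_nbrs.1 hy
      have hvis : ∃ i ≤ n, ω i = y := by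
        by_contra h
        have : y ∈ freeNbrs ω n := mem_freeNbrs.2 ⟨hy', fun i hi hiy => h ⟨i, hi, hiy⟩⟩
        rw [extCount, Finset.card_eq_zero] at h0
        rw [h0] at this
        exact Finset.notMem_empty y this
      obtain ⟨i, hi, rfl⟩ := hvis
      have hin : i ≠ n := fun h => hy'.ne (by rw [h])
      have hpar := odd_add_of_adj_apply hω hi hy'
      refine Finset.mem_image.2 ⟨i, ?_, rfl⟩
      rw [hEN, Finset.mem_filter, hP, Finset.mem_filter, Finset.mem_range]
      exact ⟨⟨by omega, by omega⟩, hy'⟩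
    calc 2 * d = (nbrs (ω n)).card := (card_nbrs _).symm
      _ ≤ (EN.image ω).card := Finset.card_le_card hsub
      _ ≤ EN.card := Finset.card_image_le
  -- the visited neighbours of the start (all of them) and their (odd) times `B`
  set U := (nbrs (ω 0)).filter fun z => ∀ i ≤ n, ω i ≠ z with hU
  set W := (nbrs (ω 0)).filter fun z => ¬ ∀ i ≤ n, ω i ≠ z with hW
  have hUW : U.card + W.card = 2 * d := by
    rw [hU, hW, Finset.card_filter_add_card_filter_not, card_nbrs]
  have hU0 : U.card ≤ 0 := (card_filter_nbrs_start_le_extCount_revWalk hω).trans h1.le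
  have hvis0 : ∀ z, (zdGraph d).Adj (ω 0) z → ∃ i ≤ n, ω i = z := fun z hz => by
    by_contra h
    have : 0 < U.card :=
      Finset.card_pos.2 ⟨z, Finset.mem_filter.2 ⟨mem_nbrs.2 hz, fun i hi hiz => h ⟨i, hi, hiz⟩⟩⟩
    omega
  set B := (Finset.range (n + 1)).filter fun j => (zdGraph d).Adj (ω 0) (ω j) with hB
  have hBmem : ∀ j ∈ B, j ≤ n ∧ j % 2 = 1 ∧ (zdGraph d).Adj (ω 0) (ω j) := by
    intro j hj
    rw [hB, Finset.mem_filter, Finset.mem_range] at hj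
    have hpar := odd_add_of_adj_apply_apply hω (Nat.zero_le n) (by omega : j ≤ n) hj.2
    exact ⟨by omega, by omega, hj.2⟩
  have hWB : W.card ≤ B.card := by
    have hsub : W ⊆ B.image ω := by
      intro z hz
      rw [hW, Finset.mem_filter] at hz
      obtain ⟨hz, hvis⟩ := hz
      have hex : ∃ i ≤ n, ω i = z := by
        by_contra h; exact hvis fun i hi hiz => h ⟨i, hi, hiz⟩
      obtain ⟨j, hj, rfl⟩ := hex
      refine Finset.mem_image.2 ⟨j, ?_, rfl⟩
      rw [hB, Finset.mem_filter, Finset.mem_range]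
      exact ⟨by omega, mem_nbrs.1 hz⟩
    exact (Finset.card_le_card hsub).trans Finset.card_image_le
  -- split `B`: the final time `n`, generic times, special times
  set Bf := B.filter fun j => ¬ j < n with hBf
  set Bl := B.filter fun j => j < n with hBl
  have hBsplit : Bl.card + Bf.card = B.card := by
    rw [hBl, hBf, Finset.card_filter_add_card_filter_not]
  set G := Bl.filter fun j => (zdGraph d).Adj (ω n) (ω (j - 1)) ∧ (zdGraph d).Adj (ω n) (ω (j + 1))
    with hG
  set Sp := Bl.filter fun j =>
    ¬ ((zdGraph d).Adj (ω n) (ω (j - 1)) ∧ (zdGraph d).Adj (ω n) (ω (j + 1))) with hSp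
  have hBlsplit : G.card + Sp.card = Bl.card := by
    rw [hG, hSp, Finset.card_filter_add_card_filter_not]
  -- special times sit next to exceptional even times: at most `2 #X` of them
  set Sp₁ := Bl.filter fun j => ¬ (zdGraph d).Adj (ω n) (ω (j - 1)) with hSp₁
  set Sp₂ := Bl.filter fun j => ¬ (zdGraph d).Adj (ω n) (ω (j + 1)) with hSp₂
  have hBlmem : ∀ j ∈ Bl, j < n ∧ j % 2 = 1 ∧ (zdGraph d).Adj (ω 0) (ω j) := by
    intro j hj
    rw [hBl, Finset.mem_filter] at hj
    obtain ⟨-, hpar, ha⟩ := hBmem j hj.1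
    exact ⟨hj.2, hpar, ha⟩
  have hSpsub : Sp ⊆ Sp₁ ∪ Sp₂ := by
    intro j hj
    rw [hSp, Finset.mem_filter, not_and_or] at hj
    rcases hj.2 with h | h
    · exact Finset.mem_union_left _ (Finset.mem_filter.2 ⟨hj.1, h⟩)
    · exact Finset.mem_union_right _ (Finset.mem_filter.2 ⟨hj.1, h⟩)
  have hSpU : Sp.card + (Sp₁ ∩ Sp₂).card ≤ Sp₁.card + Sp₂.card := by
    have := Finset.card_le_card hSpsub
    have := Finset.card_union_add_card_inter Sp₁ Sp₂
    omega
  have hSp₁X : Sp₁.card ≤ X.card := by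
    refine Finset.card_le_card_of_injOn (fun j => j - 1) (fun j hj => ?_) ?_
    · rw [Finset.mem_coe, hSp₁, Finset.mem_filter] at hj
      obtain ⟨hjn, hpar, -⟩ := hBlmem j hj.1
      show j - 1 ∈ (X : Set ℕ)
      rw [Finset.mem_coe, hX, Finset.mem_filter, hP, Finset.mem_filter, Finset.mem_range]
      exact ⟨⟨by omega, by omega⟩, hj.2⟩
    · intro j hj j' hj' h
      rw [Finset.mem_coe, hSp₁, Finset.mem_filter] at hj hj'
      have := (hBlmem j hj.1).2.1
      have := (hBlmem j' hj'.1).2.1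
      simp only at h; omega
  have hSp₂X : Sp₂.card ≤ (X.erase 0).card := by
    refine Finset.card_le_card_of_injOn (fun j => j + 1) (fun j hj => ?_) ?_
    · rw [Finset.mem_coe, hSp₂, Finset.mem_filter] at hj
      obtain ⟨hjn, hpar, -⟩ := hBlmem j hj.1
      show j + 1 ∈ ((X.erase 0 : Finset ℕ) : Set ℕ)
      rw [Finset.mem_coe, Finset.mem_erase, hX, Finset.mem_filter, hP, Finset.mem_filter,
        Finset.mem_range]
      exact ⟨by omega, ⟨by omega, by omega⟩, hj.2⟩
    · intro j _ j' _ h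
      simpa using h
  -- generic times (and the final time when `ω n ∼ 0`)
  have hGmem : ∀ j ∈ G, j < n ∧ j % 2 = 1 ∧ (zdGraph d).Adj (ω 0) (ω j) ∧
      (zdGraph d).Adj (ω n) (ω (j - 1)) ∧ (zdGraph d).Adj (ω n) (ω (j + 1)) := by
    intro j hj
    rw [hG, Finset.mem_filter] at hj
    obtain ⟨hjn, hpar, ha⟩ := hBlmem j hj.1
    exact ⟨hjn, hpar, ha, hj.2.1, hj.2.2⟩
  have hBf1 : Bf.card ≤ 1 := by
    refine (Finset.card_le_card fun j hj => ?_).trans (Finset.card_singleton n).le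
    rw [hBf, Finset.mem_filter] at hj
    have := (hBmem j hj.1).1
    exact Finset.mem_singleton.2 (by omega)
  -- `e ≁ 0`: no final time, at most two generic times, and the time `0` is exceptional
  have hBf0 : Bf.card = 0 := by
    rw [Finset.card_eq_zero, Finset.eq_empty_iff_forall_notMem]
    intro j hj
    rw [hBf, Finset.mem_filter] at hj
    obtain ⟨hjle, -, ha⟩ := hBmem j hj.1
    have : j = n := by omega
    subst this
    exact h0n ha
  have hne0 : ω n ≠ 0 := fun h => by
    have := hinj' n le_rfl 0 (Nat.zero_le n) (h.trans h00.symm); omega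
  have he2 : 2 ≤ normOne (ω n) := by
    by_contra hlt
    rcases Nat.lt_or_ge (normOne (ω n)) 1 with h | h
    · exact hne0 (normOne_eq_zero_iff.1 (by omega))
    · exact h0n (by rw [h00]; exact adj_zero_iff_normOne_eq_one.2 (by omega))
  have h0X : 0 ∈ X := by
    rw [hX, Finset.mem_filter, hP, Finset.mem_filter, Finset.mem_range]
    refine ⟨⟨by omega, by omega⟩, fun h => h0n ?_⟩
    exact h.symm
  have hXe : (X.erase 0).card + 1 = X.card := Finset.card_erase_add_one h0X
  set Q := (nbrs (ω n)).filter fun x => normOne x ≤ 2 with hQ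
  have hQ3 : Q.card ≤ 3 := card_filter_nbrs_normOne_le_two_le he2
  have hnormj : ∀ j ∈ G, normOne (ω j) = 1 := by
    intro j hj
    exact adj_zero_iff_normOne_eq_one.1 (h00 ▸ (hGmem j hj).2.2.1)
  have hQmem : ∀ j ∈ G, ω (j - 1) ∈ Q ∧ ω (j + 1) ∈ Q := by
    intro j hj
    obtain ⟨hjn, hpar, ha, hm, hp⟩ := hGmem j hj
    have h1 := hnormj j hj
    obtain ⟨k, rfl⟩ : ∃ k, j = k + 1 := ⟨j - 1, by omega⟩
    simp only [Nat.add_sub_cancel] at hm ⊢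
    have hsm := normOne_adj_cases ((hadj k (by omega)).symm)
    have hsp := normOne_adj_cases (hadj (k + 1) (by omega))
    exact ⟨Finset.mem_filter.2 ⟨mem_nbrs.2 hm, by omega⟩,
      Finset.mem_filter.2 ⟨mem_nbrs.2 hp, by omega⟩⟩
  have hG2 : G.card ≤ 2 := by
    rcases G.eq_empty_or_nonempty with hGe | hGne
    · rw [hGe]; simp
    set j₀ := G.min' hGne with hj₀
    have hj₀mem : j₀ ∈ G := Finset.min'_mem G hGne
    have hj₀le : ∀ j ∈ G, j₀ ≤ j := fun j hj => Finset.min'_le G j hj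
    set S := insert (ω (j₀ - 1)) (G.image fun j => ω (j + 1)) with hS
    have hSQ : S ⊆ Q := by
      intro x hx
      rw [hS, Finset.mem_insert] at hx
      rcases hx with rfl | hx
      · exact (hQmem j₀ hj₀mem).1
      · obtain ⟨j, hj, rfl⟩ := Finset.mem_image.1 hx
        exact (hQmem j hj).2
    have hnot : ω (j₀ - 1) ∉ G.image fun j => ω (j + 1) := by
      intro hx
      obtain ⟨j, hj, hjx⟩ := Finset.mem_image.1 hx
      have hjn := (hGmem j hj).1
      have hj0n := (hGmem j₀ hj₀mem).1
      have := hinj' (j + 1) (by omega) (j₀ - 1) (by omega) hjx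
      have := hj₀le j hj
      omega
    have hScard : S.card = G.card + 1 := by
      rw [hS, Finset.card_insert_of_notMem hnot, Finset.card_image_of_injOn]
      intro j hj j' hj' h
      rw [Finset.mem_coe] at hj hj'
      have := hinj' (j + 1) (by have := (hGmem j hj).1; omega) (j' + 1)
        (by have := (hGmem j' hj').1; omega) h
      simpa using this
    have := Finset.card_le_card hSQ
    omega
  -- start-cage times with a cage-time neighbour carry a start-neighbour within distance two of `e`:
  -- at most three of them (generic or special alike)
  set T := Bl.filter fun j => (zdGraph d).Adj (ω n) (ω (j - 1)) ∨ (zdGraph d).Adj (ω n) (ω (j + 1))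
    with hT
  have hTQ : T.card ≤ Q.card := by
    refine Finset.card_le_card_of_injOn (fun j => ω n - (ω j - ω 0)) (fun j hj => ?_) ?_
    · rw [Finset.mem_coe, hT, Finset.mem_filter] at hj
      obtain ⟨hjBl, hnear⟩ := hj
      obtain ⟨hjn, hpar, ha⟩ := hBlmem j hjBl
      show ω n - (ω j - ω 0) ∈ (↑Q : Set (Site d))
      rw [Finset.mem_coe, hQ, Finset.mem_filter, mem_nbrs, h00, sub_zero]
      rw [h00] at ha
      constructor
      · -- `e ∼ e - u` for the unit vector `u = ω j`
        have hu := (zdGraph_adj_add_right 0 (ω j) (ω n - ω j)).2 ha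
        have e1 : ω j + (ω n - ω j) = ω n := by abel
        rw [zero_add, e1] at hu
        exact hu.symm
      · -- within distance two of `e`
        rcases hnear with hm | hp
        · have hstep : (zdGraph d).Adj (ω (j - 1)) (ω j) := by
            have := hadj (j - 1) (by omega); rwa [show j - 1 + 1 = j by omega] at this
          have e1 : ω n - ω j = (ω n - ω (j - 1)) + (ω (j - 1) - ω j) := by abel
          rw [e1]
          refine (normOne_add_le _ _).trans ?_
          rw [← neg_sub (ω (j - 1)) (ω n), normOne_neg, normOne_sub_eq_one_of_adj hm, ← neg_sub (ω j),
            normOne_neg, normOne_sub_eq_one_of_adj hstep]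
        · have hstep : (zdGraph d).Adj (ω j) (ω (j + 1)) := hadj j (by omega)
          have e1 : ω n - ω j = (ω n - ω (j + 1)) + (ω (j + 1) - ω j) := by abel
          rw [e1]
          refine (normOne_add_le _ _).trans ?_
          rw [← neg_sub (ω (j + 1)) (ω n), normOne_neg, normOne_sub_eq_one_of_adj hp,
            normOne_sub_eq_one_of_adj hstep]
    · intro j hj j' hj' h
      rw [Finset.mem_coe, hT, Finset.mem_filter] at hj hj'
      have hjn := (hBlmem j hj.1).1
      have hj'n := (hBlmem j' hj'.1).1
      have : ω j = ω j' := by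
        have := h; simp only [sub_right_inj, sub_left_inj] at this; exact this
      exact hinj' j (by omega) j' (by omega) this
  -- the other start-cage times are special with two exceptional neighbours: paid twice
  have hBlT : Bl.card ≤ T.card + (Sp₁ ∩ Sp₂).card := by
    have h := Finset.card_filter_add_card_filter_not (s := Bl)
      (fun j => (zdGraph d).Adj (ω n) (ω (j - 1)) ∨ (zdGraph d).Adj (ω n) (ω (j + 1)))
    have h2 : (Bl.filter fun j => ¬ ((zdGraph d).Adj (ω n) (ω (j - 1)) ∨
        (zdGraph d).Adj (ω n) (ω (j + 1)))).card ≤ (Sp₁ ∩ Sp₂).card := by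
      refine Finset.card_le_card fun j hj => ?_
      rw [Finset.mem_filter, not_or] at hj
      exact Finset.mem_inter.2 ⟨Finset.mem_filter.2 ⟨hj.1, hj.2.1⟩, Finset.mem_filter.2 ⟨hj.1, hj.2.2⟩⟩
    rw [← hT] at h
    omega
  omega

open Classical in
/-- **`c₆d₋₁ ≤ c₆d` for every `d ≥ 4`** (stated with `n + 1 = 6d`): the escape route leaves only
both-trapped walks at this length (`SAWCountMonotoneEscapeOdd.lean`), the near-polygon rule disposes of those
next to the origin (`SAWCountMonotoneNearPolygonUnique.lean`), and none is far from it
(`le_of_bothTrapped_far`: that needs `n ≥ 8d - 5 > 6d - 1`). [cite: BDGS2012, §1.3] -/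
theorem count_le_count_succ_six_mul_sub_one (hd : 4 ≤ d) {n : ℕ} (hn : n + 1 = 6 * d) :
    count d n ≤ count d (n + 1) := by
  have hodd : Odd n := ⟨3 * d - 1, by omega⟩
  have h := count_le_count_succ_add_card_far_threshold hd hn
  have hempty : ((escapeResidual d n).filter fun ω => ¬ (zdGraph d).Adj (ω n) (ω 0)) = ∅ := by
    refine Finset.eq_empty_of_forall_notMem fun ω hω => ?_
    obtain ⟨hR, hfar⟩ := Finset.mem_filter.1 hω
    obtain ⟨hs, -, hb⟩ := mem_escapeResidual.1 hR
    have ht := extCount_eq_zero_of_mem_escapeResidual_of_odd (by omega) hodd (by omega) hR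
    have := le_of_bothTrapped_far hs hodd ht hb (fun h' => hfar h'.symm)
    omega
  rw [hempty, Finset.card_empty, add_zero] at h
  exact h

/-- **`cₙ ≤ cₙ₊₁` for all `n ≤ 6d - 1`, every `d ≥ 4`** (`n ≤ 6d - 2` by `SAWCountMonotoneEscapeOdd.lean`, the
length `6d - 1` by `count_le_count_succ_six_mul_sub_one`). [cite: BDGS2012, §1.3] -/
theorem count_le_count_succ_of_le_six_mul' (hd : 4 ≤ d) {n : ℕ} (hn : n + 1 ≤ 6 * d) :
    count d n ≤ count d (n + 1) := by
  rcases Nat.lt_or_ge (n + 1) (6 * d) with h | h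
  · exact count_le_count_succ_of_le_six_mul_sub_two (by omega) (by omega)
  · exact count_le_count_succ_six_mul_sub_one hd (by omega)

/-- **`cₘ ≤ cₙ` for all `m ≤ n ≤ 6d + 1`, every `d ≥ 4`**: the one-step inequalities up to `6d - 1` and the
even length `6d ≤ 8d - 6` (`count_le_count_succ_of_even_le`). (`d = 4`: `n ≤ 25`; `d = 5`: `n ≤ 31`.)
[cite: BDGS2012, §1.3] -/
theorem count_mono_of_le_six_mul (hd : 4 ≤ d) {m n : ℕ} (hmn : m ≤ n) (hn : n ≤ 6 * d + 1) :
    count d m ≤ count d n := by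
  induction n with
  | zero =>
    obtain rfl : m = 0 := by omega
    exact le_rfl
  | succ n ih =>
    rcases Nat.lt_or_ge m (n + 1) with hlt | hge
    · refine (ih (by omega) (by omega)).trans ?_
      rcases Nat.lt_or_ge n (6 * d) with h | h
      · exact count_le_count_succ_of_le_six_mul' hd (by omega)
      · have hn6 : n = 6 * d := by omega
        exact count_le_count_succ_of_even_le ⟨3 * d, by omega⟩ (by omega)
    · obtain rfl : m = n + 1 := by omega
      exact le_rfl

end Literature.Probability.RandomPlanarGeometry.SAW.Zd
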